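import Mathlib
import Literature.NumberTheory.LFunctions.Zhang2022.Section7Eq75LargeSieve
import Literature.NumberTheory.LFunctions.Zhang2022.Section7aStatements
import Literature.NumberTheory.LFunctions.Zhang2022.Section3Lemma34
import Literature.NumberTheory.LFunctions.Zhang2022.Section3Lemma35Holds
import Literature.NumberTheory.LFunctions.Zhang2022.Section3Lemma36Holds
import HarnessLib

/-!
# Zhang (2022) §7, (7.5): the DAG nodes `Z22:§7.u019` and `Z22:(7.5)` DISCHARGED —
# `(κ∗a₁)(m) = O(τ₅(m))`, the Cauchy chain, and "(7.5) by Proposition 2.1 and (2.9)"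

Topic `Literature/NumberTheory/LFunctions/Zhang2022` (Landau–Siegel adjudication tree;
verdict-neutral). Y. Zhang, *Discrete mean estimates and the Landau–Siegel zero*,
arXiv:2211.02515v1 (2022) [Zhang2022LandauSiegel] — **an unrefereed manuscript under adjudication**
— §7 «Mean-value formula I», proof of Proposition 7.1, «Initial steps» (PDF pp. 34–35, tex
L1899–L1910):

> By (7.4), the proof of (7.3) is reduced to showing that
> `Σ_{ψ∈Ψ₂} |Σ_{m<P²} (κ∗a₁)(m)ψ(m)m^{−s}| |A(𝐚₂;1−s,ψ̄)| = o(𝔓)`, `σ = 1/2`.  (7.5)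
> Note that `(κ∗a₁)(m) = O(τ₅(m))`. The left side above is, by Cauchy's inequality,
> `≤ (Σ_{ψ∈Ψ}|Σ_{m<P²}(κ∗a₁)(m)ψ(m)m^{−s}|²)^{1/2}(Σ_{ψ∈Ψ}|A(𝐚₂;1−s,ψ̄)|⁴)^{1/4}(Σ_{ψ∈Ψ₂}1)^{1/4}`
> `≪ (P²Σ_{m<P²}τ₅(m)²/m)^{1/2}(P²Σ_{m<P²}τ₂(m)²/m)^{1/4}(Σ_{ψ∈Ψ₂}1)^{1/4}`.
> This yields (7.5) by Proposition 2.1 and (2.9).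

D-0069 campaign (cell `siegel-zhang`), discharge prover sz-d18. The statements are slice L2-t2's
typed nodes (`Section7aStatements`, namespace `…Zhang2022.Section7aStatements`), concluded here BY
NAME: `Step7u019kappa c′` (the prose claim `(κ∗a₁)(m) = O(τ₅(m))`), `Step7u019a c′` (the
Cauchy/Hölder line), `Step7u019b c′` (the `≪` line), the deduction
`DedEq75 c′ := Step7u019kappa → Step7u019a → Step7u019b → Skeleton.Prop21 → Eq75`, and hence
`Eq75 c′` ((7.5) itself) — first from the named antecedent `Skeleton.Prop21` (Proposition 2.1:
"Here Proposition 2.1 is crucial", p. 34), then UNCONDITIONALLY (`eq75_holds`), Proposition 2.1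
being by now a theorem of the tree through its §3 inputs (`Skeleton.lemma34_holds`,
`Skeleton.lemma35_holds`, `Skeleton.lemma36_holds` and the skeleton edge `Skeleton.prop21_of_lemmas`). Inputs, all THEOREMS of the tree
(0 new facts): Lemma 3.3 (ii) `Skeleton.lemma33b_holds` (large sieve for primitive characters),
(2.9) `frakP_bounds`, the divisor counts `MeanSquareMajorant.sum_tau_sq_div_le`, and the two
companion files `Section7Eq75Majorants` (`|κ| ≤ τ₄`, Hölder `(2,4,4)`, the square of a Dirichlet
polynomial) and `Section7Eq75LargeSieve` (the two large-sieve factors, the exponent count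
`𝓛^{(450+36−739)/4} = 𝓛^{−63.25}` beyond `P^{3/2}`, against `𝔓^{3/4} ≍ P^{3/2}𝓛^{−57.75}`).

| node | decl here | status |
|---|---|---|
| `Z22:§7.u019` prose | `step7u019kappa_holds : Step7u019kappa c′` (`C = B`) | DISCHARGED |
| `Z22:§7.u019` line 1 | `step7u019a_holds : Step7u019a c′` | DISCHARGED |
| `Z22:§7.u019` line 2 | `step7u019b_holds : Step7u019b c′` (`C = (C₀⁺B⁺²)^{1/2}(C₀⁺B⁺⁴)^{1/4}`, `D ≥ 2`) | DISCHARGED |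
| `Z22:(7.5)` deduction | `dedEq75_holds : DedEq75 c′` | DISCHARGED |
| `Z22:(7.5)` | `eq75_of_prop21 : Skeleton.Prop21 → Eq75 c′`; **`eq75_holds : Eq75 c′`** | DISCHARGED (Prop. 2.1 via the tree's `lemma34/35/36_holds` + `prop21_of_lemmas`) |

This refines the clause "(7.4)–(7.5): Cauchy and the large sieve" of the skeleton's proof node
`Skeleton.Ded71 c′` (Proposition 7.1). WHAT THIS FILE IS NOT: a proof of (7.3), of Proposition
7.1 or of Proposition 2.1, and not any claim about the manuscript's Theorems 1–2 or about
Landau–Siegel zeros.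

## References

* Y. Zhang, arXiv:2211.02515v1 (2022), §7 (7.5) p. 35; §3 Lemma 3.3 p. 14; §2 Prop. 2.1, (2.9).
  [cite: Zhang2022LandauSiegel, §7 (7.5) p.35]
-/

noncomputable section

open Complex Real ComplexConjugate

namespace Literature.NumberTheory.LFunctions.Zhang2022.Section7Eq75

open Finset MeanSquareMajorant ArithmeticFunction

/-! ### Bookkeeping over the family `Ψ` -/

section Family

variable {D : ℕ}

/-- A sum over the type `Ψ` (`Skeleton.Chr D`) is the sum over the `Finset` `PsiAll D`
(`= finsetOf univ`, slice L2-t2's "`Σ_{ψ∈Ψ}`"). [cite: Zhang2022LandauSiegel, §7 p.35, tex L1905] -/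
theorem finsum_eq_sum_PsiAll {M : Type*} [AddCommMonoid M] (f : Skeleton.Chr D → M) :
    ∑ᶠ x, f x = ∑ x ∈ Section7aStatements.PsiAll D, f x := by
  classical
  haveI : Fintype (Skeleton.Chr D) := Fintype.ofFinite _
  rw [finsum_eq_sum_of_fintype]
  refine Finset.sum_congr ?_ fun _ _ => rfl
  ext x
  simp only [Finset.mem_univ, Section7aStatements.PsiAll,
    Skeleton.mem_finsetOf Set.finite_univ, Set.mem_univ]

/-- `Ψ₂ ⊆ Ψ` at the level of the `Finset`s. [cite: Zhang2022LandauSiegel, §2 Prop. 2.1 p.9] -/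
theorem finsetOf_PsiTwo_subset [NeZero D] (χ : DirichletCharacter ℂ D) :
    Skeleton.finsetOf (Skeleton.PsiTwo χ) ⊆ Section7aStatements.PsiAll D := fun x _ => by
  rw [Section7aStatements.PsiAll, Skeleton.mem_finsetOf Set.finite_univ]; trivial

/-- `#(finsetOf Ψ₂) = #Ψ₂` ("`Σ_{ψ∈Ψ₂} 1`" as `Set.ncard`, the form of `Skeleton.Prop21`).
[cite: Zhang2022LandauSiegel, §2 Prop. 2.1 p.9] -/
theorem card_finsetOf_PsiTwo [NeZero D] (χ : DirichletCharacter ℂ D) :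
    ((Skeleton.finsetOf (Skeleton.PsiTwo χ)).card : ℝ) = ((Skeleton.PsiTwo χ).ncard : ℝ) := by
  have hfin : (Skeleton.PsiTwo χ).Finite := Set.toFinite _
  rw [Skeleton.finsetOf, dif_pos hfin, Set.ncard_eq_toFinset_card _ hfin]

end Family

/-! ### The nodes -/

/-- **`Z22:§7.u019` prose claim DISCHARGED**: "Note that `(κ∗a₁)(m) = O(τ₅(m))`" for `𝐚₁`
satisfying (7.2), with the constant `B` of (7.2) (`|κ| ≤ τ₄`, `norm_conv_kappa_le`).
[cite: Zhang2022LandauSiegel, §7 p.35, tex L1903] -/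
theorem step7u019kappa_holds (c' : ℝ) : Section7aStatements.Step7u019kappa c' := by
  intro B
  refine ⟨B, fun D a₁ ha m _ => ?_⟩
  exact norm_conv_kappa_le _ _ _ ha.1 m

variable (c' : ℝ) in
/-- `Step7u019kappa` — `_holds` alias of `step7u019kappa_holds` above under the fact's exact name, stated under the
prover's own binders as section variables (appended 2026-08-28, D-0026 bookkeeping: the proof term is the
existing theorem of this file; no statement, definition or attribute is edited; no new named fact; the
ledger's debt table listed the fact unproved). [cite: Zhang2022LandauSiegel, §7 p.35, tex L1903] -/
theorem _root_.Literature.NumberTheory.LFunctions.Zhang2022.Section7aStatements.Step7u019kappa_holds :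
    _root_.Literature.NumberTheory.LFunctions.Zhang2022.Section7aStatements.Step7u019kappa c' :=
  _root_.Literature.NumberTheory.LFunctions.Zhang2022.Section7Eq75.step7u019kappa_holds (c' := c')

/-- **`Z22:§7.u019`, first line, DISCHARGED** ("The left side above is, by Cauchy's inequality,
`≤ (Σ_Ψ |Σ_{m<P²}(κ∗a₁)(m)ψ(m)m^{−s}|²)^{1/2} (Σ_Ψ |A(𝐚₂;1−s,ψ̄)|⁴)^{1/4} (Σ_{Ψ₂} 1)^{1/4}`"):
Hölder `(2,4,4)` over `Ψ₂ ⊆ Ψ` (`sum_mul_le_holder`). [cite: Zhang2022LandauSiegel, §7 p.35, tex L1904] -/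
theorem step7u019a_holds (c' : ℝ) : Section7aStatements.Step7u019a c' := by
  intro D _ χ a₁ a₂ s _
  rw [← card_finsetOf_PsiTwo χ]
  exact sum_mul_le_holder _ _ (finsetOf_PsiTwo_subset χ) _ _ (fun _ => norm_nonneg _)
    (fun _ => norm_nonneg _)

variable (c' : ℝ) in
/-- `Step7u019a` — `_holds` alias of `step7u019a_holds` above under the fact's exact name, stated under the
prover's own binders as section variables (appended 2026-08-28, D-0026 bookkeeping: the proof term is the
existing theorem of this file; no statement, definition or attribute is edited; no new named fact; the
ledger's debt table listed the fact unproved). [cite: Zhang2022LandauSiegel, §7 p.35, tex L1904] -/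
theorem _root_.Literature.NumberTheory.LFunctions.Zhang2022.Section7aStatements.Step7u019a_holds :
    _root_.Literature.NumberTheory.LFunctions.Zhang2022.Section7aStatements.Step7u019a c' :=
  _root_.Literature.NumberTheory.LFunctions.Zhang2022.Section7Eq75.step7u019a_holds (c' := c')

/-- **`Z22:§7.u019`, second line, DISCHARGED** (the "`≪`" of the Cauchy chain, p. 35): for
`𝐚₁, 𝐚₂` satisfying (7.2), `σ = 1/2` and every `D ≥ 2`,
`(Σ_Ψ|Σ_{m<P²}(κ∗a₁)ψm^{−s}|²)^{1/2}(Σ_Ψ|A(𝐚₂;1−s,ψ̄)|⁴)^{1/4}(#Ψ₂)^{1/4}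
 ≤ C (P²Σ_{m<P²}τ₅²/m)^{1/2}(P²Σ_{m<P²}τ₂²/m)^{1/4}(#Ψ₂)^{1/4}`, `C = (C₀⁺B⁺²)^{1/2}(C₀⁺B⁺⁴)^{1/4}`
with `C₀` the constant of Lemma 3.3 (ii) (tree: `Skeleton.lemma33b_holds`; factors
`finsum_norm_sq_dirPoly_le`, `finsum_norm_ApolyBar_pow_four_le`).
[cite: Zhang2022LandauSiegel, §7 p.35, tex L1904–L1908] -/
theorem step7u019b_holds (c' : ℝ) : Section7aStatements.Step7u019b c' := by
  intro B
  obtain ⟨C₀, h33⟩ := Skeleton.lemma33b_holds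
  refine ⟨(max C₀ 0 * (max B 0) ^ 2) ^ (1 / 2 : ℝ) * (max C₀ 0 * (max B 0) ^ 4) ^ (1 / 4 : ℝ), 2,
    fun D _ χ hD _ _ a₁ a₂ ha₁ ha₂ s hs => ?_⟩
  have hT : 1 < Skeleton.bigT D := one_lt_bigT hD
  have hw : (1 - s).re = 1 / 2 := by rw [Complex.sub_re, Complex.one_re, hs]; norm_num
  have hB0 : 0 ≤ max B 0 := le_max_right _ _
  have hc : ∀ m, m ≠ 0 → ‖Section7aStatements.kconv c' D a₁ m‖ ≤ max B 0 * tau 5 m :=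
    fun m _ => norm_conv_kappa_le _ _ _ (fun n => (ha₁.1 n).trans (le_max_left _ _)) m
  have hI : ∑ x ∈ Section7aStatements.PsiAll D, ‖Section7aStatements.kconvHead c' x a₁ s‖ ^ 2 ≤
      max C₀ 0 * (max B 0) ^ 2 * (Skeleton.bigP D ^ 2 *
        ∑ m ∈ Finset.Ico 1 ⌈Skeleton.bigP D ^ 2⌉₊, tau 5 m ^ 2 / (m : ℝ)) := by
    rw [← finsum_eq_sum_PsiAll]
    exact finsum_norm_sq_dirPoly_le h33 hc hs
  have hII : ∑ x ∈ Section7aStatements.PsiAll D, ‖Skeleton.ApolyBar x a₂ (1 - s)‖ ^ 4 ≤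
      max C₀ 0 * (max B 0) ^ 4 * (Skeleton.bigP D ^ 2 *
        ∑ m ∈ Finset.Ico 1 ⌈Skeleton.bigP D ^ 2⌉₊, tau 2 m ^ 2 / (m : ℝ)) := by
    rw [← finsum_eq_sum_PsiAll]
    exact finsum_norm_ApolyBar_pow_four_le h33 hT ha₂.1 hw
  set S5 := Skeleton.bigP D ^ 2 *
    ∑ m ∈ Finset.Ico 1 ⌈Skeleton.bigP D ^ 2⌉₊, tau 5 m ^ 2 / (m : ℝ) with hS5def
  set S2 := Skeleton.bigP D ^ 2 *
    ∑ m ∈ Finset.Ico 1 ⌈Skeleton.bigP D ^ 2⌉₊, tau 2 m ^ 2 / (m : ℝ) with hS2def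
  have hS5 : 0 ≤ S5 := mul_nonneg (sq_nonneg _)
    (Finset.sum_nonneg fun m _ => div_nonneg (sq_nonneg _) (Nat.cast_nonneg _))
  have hS2 : 0 ≤ S2 := mul_nonneg (sq_nonneg _)
    (Finset.sum_nonneg fun m _ => div_nonneg (sq_nonneg _) (Nat.cast_nonneg _))
  have h1 : (∑ x ∈ Section7aStatements.PsiAll D,
      ‖Section7aStatements.kconvHead c' x a₁ s‖ ^ 2) ^ (1 / 2 : ℝ) ≤
        (max C₀ 0 * (max B 0) ^ 2) ^ (1 / 2 : ℝ) * S5 ^ (1 / 2 : ℝ) := by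
    rw [← Real.mul_rpow (by positivity) hS5]
    exact Real.rpow_le_rpow (Finset.sum_nonneg fun _ _ => by positivity) hI (by norm_num)
  have h2 : (∑ x ∈ Section7aStatements.PsiAll D,
      ‖Skeleton.ApolyBar x a₂ (1 - s)‖ ^ 4) ^ (1 / 4 : ℝ) ≤
        (max C₀ 0 * (max B 0) ^ 4) ^ (1 / 4 : ℝ) * S2 ^ (1 / 4 : ℝ) := by
    rw [← Real.mul_rpow (by positivity) hS2]
    exact Real.rpow_le_rpow (Finset.sum_nonneg fun _ _ => by positivity) hII (by norm_num)
  calc _ ≤ ((max C₀ 0 * (max B 0) ^ 2) ^ (1 / 2 : ℝ) * S5 ^ (1 / 2 : ℝ)) *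
        ((max C₀ 0 * (max B 0) ^ 4) ^ (1 / 4 : ℝ) * S2 ^ (1 / 4 : ℝ)) *
        ((Skeleton.PsiTwo χ).ncard : ℝ) ^ (1 / 4 : ℝ) := by
        apply mul_le_mul_of_nonneg_right _ (by positivity)
        exact mul_le_mul h1 h2 (by positivity) (by positivity)
    _ = _ := by ring

variable (c' : ℝ) in
/-- `Step7u019b` — `_holds` alias of `step7u019b_holds` above under the fact's exact name, stated under the
prover's own binders as section variables (appended 2026-08-28, D-0026 bookkeeping: the proof term is the
existing theorem of this file; no statement, definition or attribute is edited; no new named fact; the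
ledger's debt table listed the fact unproved). [cite: Zhang2022LandauSiegel, §7 p.35, tex L1904–L1908] -/
theorem _root_.Literature.NumberTheory.LFunctions.Zhang2022.Section7aStatements.Step7u019b_holds :
    _root_.Literature.NumberTheory.LFunctions.Zhang2022.Section7aStatements.Step7u019b c' :=
  _root_.Literature.NumberTheory.LFunctions.Zhang2022.Section7Eq75.step7u019b_holds (c' := c')

/-- **`Z22:(7.5)` DEDUCTION DISCHARGED** ("This yields (7.5) by Proposition 2.1 and (2.9)", p. 35):
the Cauchy chain (`Step7u019a`, `Step7u019b`), Proposition 2.1 (`#Ψ₂ ≪ 𝔓𝓛⁻⁷³⁹`, the banked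
CLAIM `Skeleton.Prop21`, as antecedent) and (2.9) (`𝔓 = (1+o(1))P²𝓛⁻⁷⁷`, the tree THEOREM
`frakP_bounds`) give (7.5): the right side is
`≪ (P²𝓛²²⁵)^{1/2}(P²𝓛³⁶)^{1/4}(𝔓𝓛⁻⁷³⁹)^{1/4} ≪ P²𝓛^{−82.5} = o(P²𝓛⁻⁷⁷) = o(𝔓)`
(`le_eps_mul_of_bounds`). [cite: Zhang2022LandauSiegel, §7 (7.5) p.35, tex L1900–L1910] -/
theorem dedEq75_holds (c' : ℝ) : Section7aStatements.DedEq75 c' := by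
  intro _ ha hb h21 B ε hε
  obtain ⟨C, D₁, hD₁⟩ := hb B
  obtain ⟨C₂₁, D₂, hD₂⟩ := h21
  obtain ⟨D₃, hD₃⟩ := frakP_bounds
  obtain ⟨D₄, hD₄⟩ := exists_nat_le_ell
    (max (8 * (|C| ^ 4 * majorantConst (5 ^ 2) (2 * 5) ^ 2 * majorantConst (2 ^ 2) (2 * 2) *
      |C₂₁| * 2 ^ 54) / ε ^ 4) 6)
  refine ⟨max (max D₁ D₂) (max D₃ D₄), fun D _ χ hD hq hp hA a₁ a₂ ha₁ ha₂ s hs => ?_⟩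
  have hD1 : D₁ ≤ D := le_trans (le_trans (le_max_left _ _) (le_max_left _ _)) hD
  have hD2 : D₂ ≤ D := le_trans (le_trans (le_max_right _ _) (le_max_left _ _)) hD
  have hD3 : D₃ ≤ D := le_trans (le_trans (le_max_left _ _) (le_max_right _ _)) hD
  have hD4 : D₄ ≤ D := le_trans (le_trans (le_max_right _ _) (le_max_right _ _)) hD
  have hLmax := hD₄ D hD4
  have hL6 : 6 ≤ Skeleton.ell D := le_trans (le_max_right _ _) hLmax
  have hL1 : 1 ≤ Skeleton.ell D := by linarith
  have hX := (ha D χ a₁ a₂ s hs).trans (hD₁ D χ hD1 hq hp a₁ a₂ ha₁ ha₂ s hs)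
  exact le_eps_mul_of_bounds hε (Real.exp_pos _)
    (Finset.sum_nonneg fun m _ => div_nonneg (sq_nonneg _) (Nat.cast_nonneg _))
    (Finset.sum_nonneg fun m _ => div_nonneg (sq_nonneg _) (Nat.cast_nonneg _))
    (Nat.cast_nonneg _) (majorantConst_pos _ _).le hX
    (sum_tau_sq_div_Ico_le 5 hL1) (sum_tau_sq_div_Ico_le 2 hL1) (hD₂ D χ hD2 hq hp hA)
    (hD₃ D hD3) hL6 (le_trans (le_max_left _ _) hLmax)

variable (c' : ℝ) in
/-- `DedEq75` — `_holds` alias of `dedEq75_holds` above under the fact's exact name, stated under the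
prover's own binders as section variables (appended 2026-08-28, D-0026 bookkeeping: the proof term is the
existing theorem of this file; no statement, definition or attribute is edited; no new named fact; the
ledger's debt table listed the fact unproved). [cite: Zhang2022LandauSiegel, §7 (7.5) p.35, tex L1900–L1910] -/
theorem _root_.Literature.NumberTheory.LFunctions.Zhang2022.Section7aStatements.DedEq75_holds :
    _root_.Literature.NumberTheory.LFunctions.Zhang2022.Section7aStatements.DedEq75 c' :=
  _root_.Literature.NumberTheory.LFunctions.Zhang2022.Section7Eq75.dedEq75_holds (c' := c')

/-- **(7.5) HOLDS modulo Proposition 2.1**: `Skeleton.Prop21 → Eq75 c′` — composing the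
discharged Cauchy chain (`step7u019kappa_holds`, `step7u019a_holds`, `step7u019b_holds`) with the
deduction `dedEq75_holds`; Proposition 2.1 ("Here Proposition 2.1 is crucial", p. 34) remains the
one named antecedent (a CLAIM node of the skeleton, proved in §3 of the manuscript from Lemmas
3.4–3.6: `Skeleton.prop21_of_lemmas`). [cite: Zhang2022LandauSiegel, §7 (7.5) p.35, tex L1900–L1910] -/
theorem eq75_of_prop21 (c' : ℝ) (h21 : Skeleton.Prop21) : Section7aStatements.Eq75 c' :=
  dedEq75_holds c' (step7u019kappa_holds c') (step7u019a_holds c') (step7u019b_holds c') h21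


/-- **(7.5) HOLDS modulo Lemmas 3.4–3.6** (the §3 inputs of Proposition 2.1, via the skeleton's
kernel edge `Skeleton.prop21_of_lemmas`): `Lemma34 → Lemma35 → Lemma36 → Eq75 c′`.
[cite: Zhang2022LandauSiegel, §7 (7.5) p.35; §3 p.14] -/
theorem eq75_of_lemmas (c' : ℝ) (h34 : Skeleton.Lemma34) (h35 : Skeleton.Lemma35)
    (h36 : Skeleton.Lemma36) : Section7aStatements.Eq75 c' :=
  eq75_of_prop21 c' (Skeleton.prop21_of_lemmas h34 h35 h36)

/-- **(7.5) HOLDS** (`Z22:(7.5)` DISCHARGED, unconditionally in `c′`): Lemmas 3.4, 3.5, 3.6 are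
theorems of the tree (`Skeleton.lemma34_holds`, `Skeleton.lemma35_holds`, `Skeleton.lemma36_holds`),
hence so is Proposition 2.1 (`Skeleton.prop21_of_lemmas`), and `eq75_of_lemmas` closes (7.5):
for `𝐚₁, 𝐚₂` satisfying (7.2) and `σ = 1/2`, under (A),
`Σ_{ψ∈Ψ₂}|Σ_{m<P²}(κ∗a₁)(m)ψ(m)m^{−s}||A(𝐚₂;1−s,ψ̄)| = o(𝔓)`.
[cite: Zhang2022LandauSiegel, §7 (7.5) p.35, tex L1900–L1910] -/
theorem eq75_holds (c' : ℝ) : Section7aStatements.Eq75 c' :=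
  eq75_of_lemmas c' Skeleton.lemma34_holds Skeleton.lemma35_holds Skeleton.lemma36_holds

variable (c' : ℝ) in
/-- `Eq75` — `_holds` alias of `eq75_holds` above under the fact's exact name, stated under the
prover's own binders as section variables (appended 2026-08-28, D-0026 bookkeeping: the proof term is the
existing theorem of this file; no statement, definition or attribute is edited; no new named fact; the
ledger's debt table listed the fact unproved). [cite: Zhang2022LandauSiegel, §7 (7.5) p.35, tex L1900–L1910] -/
theorem _root_.Literature.NumberTheory.LFunctions.Zhang2022.Section7aStatements.Eq75_holds :
    _root_.Literature.NumberTheory.LFunctions.Zhang2022.Section7aStatements.Eq75 c' :=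
  _root_.Literature.NumberTheory.LFunctions.Zhang2022.Section7Eq75.eq75_holds (c' := c')

end Literature.NumberTheory.LFunctions.Zhang2022.Section7Eq75
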